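import Summits.Schanuel.Schanuel.Theorems.RootDecomp1KHyper13

/-!
# RootDecomp1KHyper — part 14 of the «HyperCarving» port wave (lens 6, gen 9 = ROUND 4 of route-Schanuel-RootDecomp1K; 19 parts planned)

Mechanical port (census-1 gen 7, dependency closure; tools census/tools/gen7/portkit2.py + build_l6g9.py) of §17 of HOME/decomp-schanuel-lens-6/g9/HyperCarving.lean
(sha256 aba5c91f…, 8041 l; critic CLEARED FOR TYPING 2026-08-30T13:33:07Z; writer PATH A″ rev 5–8) together with the §§0–16 declarations it depends on
(nothing of the node was in the tree before except RootDecomp1KLinLiouvilleSplit and the Literature fact NesterenkoWaldschmidt1996_thm_5_1).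
This part: node lines 6132–6482 (25 declarations: exists_hyperLiouville_ratio_of_hyperLinLiouville, hyperLinLiouville_of_hyperLiouville_ratio, hyperLinLiouville_pair_iff, not_hyperLinLiouville_of_ratio_not_hyperLiouville, hyperLinLiouville_sq, hyperLinLiouville_one …).
All parts share the namespace `Summit.Schanuel.Schanuel.Theorems.RootDecomp1KHyper` (node sub-namespace `HyperCell` reproduced); statements and proofs
are the node's verbatim; `--supports stmt-Schanuel-33363` (A₄ʰ HyperLiouvilleSchanuel). Sorry-free; standard axioms. Nothing here proves Schanuel; rung 0.
-/

set_option linter.dupNamespace false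
set_option linter.unusedSectionVars false

noncomputable section

open Complex IntermediateField Filter Polynomial

namespace Summit.Schanuel.Schanuel.Theorems.RootDecomp1KHyper

variable {n K : ℕ}

namespace HyperCell

variable {n K : ℕ}

/-- `exp(−x) ≤ 1/x` for `x > 0`. -/
private theorem exp_neg_le_one_div {x : ℝ} (hx : 0 < x) : Real.exp (-x) ≤ 1 / x := by
  rw [Real.exp_neg, ← one_div]
  exact one_div_le_one_div_of_le hx (by linarith [Real.add_one_le_exp x])

/-- §17a. The round-4 cut predicate: auxiliary statement `exp_neg_two_pow_le` (lens 6 gen 9 node, ported verbatim). -/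
private theorem exp_neg_two_pow_le (m : ℕ) : Real.exp (-(2 : ℝ) ^ m) ≤ 1 / 2 ^ m :=
  exp_neg_le_one_div (by positivity)

/-- **Structure of `HyperLinLiouville` pairs.** A ℚ-free pair is `HyperLinLiouville` only if
`z₁ = ρ · z₀` with `ρ` a real HYPER-Liouville number: the small forms `h₀z₀ + h₁z₁ = z₀(h₀ + h₁ρ)`
give rationals `−h₀/h₁` with `|ρ + h₀/h₁| < exp(−(1+S)^M)`, `den ≤ |h₁| ≤ S`; irrationality of `ρ`
forces `den → ∞` along the sequence. -/
theorem exists_hyperLiouville_ratio_of_hyperLinLiouville {z : Fin 2 → ℂ}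
    (hz : LinearIndependent ℚ z) (hH : HyperLinLiouville z) :
    ∃ ρ : ℝ, HyperLiouville ρ ∧ z 1 = (ρ : ℂ) * z 0 := by
  have h0 : z 0 ≠ 0 := hz.ne_zero 0
  have hn0 : 0 < ‖z 0‖ := norm_pos_iff.mpr h0
  obtain ⟨ρ, hρL, hz1⟩ := exists_liouville_ratio_of_linLiouville hz hH.linLiouville
  have hρirr : Irrational ρ := hρL.irrational
  refine ⟨ρ, fun m => ?_, hz1⟩
  have hform : ∀ h : Fin 2 → ℤ,
      ‖∑ i, (h i : ℂ) * z i‖ = ‖z 0‖ * |(h 0 : ℝ) + (h 1 : ℝ) * ρ| := by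
    intro h
    have e : ∑ i, (h i : ℂ) * z i = z 0 * (((h 0 : ℝ) + (h 1 : ℝ) * ρ : ℝ) : ℂ) := by
      rw [form_two, hz1]; push_cast; ring
    rw [e, norm_mul, Complex.norm_real, Real.norm_eq_abs]
  -- a positive lower bound for the distance from `ρ` to the rationals of denominator `≤ m`
  obtain ⟨ε, hε0, hε⟩ : ∃ ε : ℝ, 0 < ε ∧ ∀ r : ℚ, r.den ≤ m → ε ≤ |ρ - r| := by
    have hev := hρirr.eventually_forall_le_dist_cast_rat_of_den_le m
    obtain ⟨ε, hε, hε0⟩ :=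
      ((hev.filter_mono nhdsWithin_le_nhds).and (self_mem_nhdsWithin (s := Set.Ioi (0 : ℝ)))).exists
    exact ⟨ε, hε0, fun r hr => by simpa [Real.dist_eq] using hε r hr⟩
  -- the level
  obtain ⟨c₁, hc₁⟩ := exists_half_pow_le hn0
  obtain ⟨c₂, hc₂⟩ := exists_half_pow_le (mul_pos hε0 hn0)
  obtain ⟨h, hh, hlt⟩ := hH (m + c₁ + c₂ + 1)
  set M : ℕ := m + c₁ + c₂ with hM
  set S : ℝ := ∑ i, (|h i| : ℝ) with hSdef
  have hS1 : 1 ≤ S := one_le_hsum hh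
  have hS2 : (2 : ℝ) ≤ 1 + S := by linarith
  rw [hform h] at hlt
  set f : ℝ := (h 0 : ℝ) + (h 1 : ℝ) * ρ with hf
  -- `exp(−(1+S)^(M+1)) ≤ exp(−(1+S)^M) · exp(−2^M)`
  have hsplit : Real.exp (-((1 + S) ^ (M + 1))) ≤
      Real.exp (-((1 + S) ^ M)) * Real.exp (-(2 : ℝ) ^ M) := by
    rw [← Real.exp_add]
    apply Real.exp_le_exp.mpr
    have h2M : (2 : ℝ) ^ M ≤ (1 + S) ^ M := pow_le_pow_left₀ (by norm_num) hS2 M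
    have hpos : (0 : ℝ) ≤ (1 + S) ^ M := by positivity
    have : (1 + S) ^ M + 2 ^ M ≤ (1 + S) ^ (M + 1) := by rw [pow_succ]; nlinarith
    linarith
  have hexp1 : Real.exp (-((1 + S) ^ M)) ≤ 1 := by
    rw [Real.exp_le_one_iff]; linarith [pow_nonneg (by positivity : (0 : ℝ) ≤ 1 + S) M]
  have h2c₁ : Real.exp (-(2 : ℝ) ^ M) ≤ ‖z 0‖ :=
    calc Real.exp (-(2 : ℝ) ^ M) ≤ 1 / 2 ^ M := exp_neg_two_pow_le M
      _ ≤ 1 / 2 ^ c₁ := one_div_le_one_div_of_le (by positivity)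
          (pow_le_pow_right₀ (by norm_num) (by omega))
      _ ≤ ‖z 0‖ := hc₁
  have h2c₂ : Real.exp (-(2 : ℝ) ^ M) ≤ ε * ‖z 0‖ :=
    calc Real.exp (-(2 : ℝ) ^ M) ≤ 1 / 2 ^ M := exp_neg_two_pow_le M
      _ ≤ 1 / 2 ^ c₂ := one_div_le_one_div_of_le (by positivity)
          (pow_le_pow_right₀ (by norm_num) (by omega))
      _ ≤ ε * ‖z 0‖ := hc₂
  -- two consequences of smallness: `‖z0‖ |f| < exp(−2^M)` and `|f| < exp(−(1+S)^M)`
  have hltA : ‖z 0‖ * |f| < Real.exp (-(2 : ℝ) ^ M) := by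
    refine hlt.trans_le (hsplit.trans ?_)
    calc Real.exp (-((1 + S) ^ M)) * Real.exp (-(2 : ℝ) ^ M)
        ≤ 1 * Real.exp (-(2 : ℝ) ^ M) := by gcongr
      _ = Real.exp (-(2 : ℝ) ^ M) := one_mul _
  have hltB : |f| < Real.exp (-((1 + S) ^ M)) := by
    have h3 : ‖z 0‖ * |f| < ‖z 0‖ * Real.exp (-((1 + S) ^ M)) := by
      refine hlt.trans_le (hsplit.trans ?_)
      rw [mul_comm (‖z 0‖)]
      gcongr
    exact lt_of_mul_lt_mul_left h3 hn0.le
  -- `h 1 ≠ 0`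
  have h1 : h 1 ≠ 0 := by
    intro h10
    have h00 : h 0 ≠ 0 := by
      intro h00; apply hh; funext i; fin_cases i <;> simp [h00, h10]
    have hge : ‖z 0‖ ≤ ‖z 0‖ * |f| := by
      rw [hf]; simp only [h10, Int.cast_zero, zero_mul, add_zero]
      have : (1 : ℝ) ≤ |(h 0 : ℝ)| := by exact_mod_cast Int.one_le_abs h00
      exact le_mul_of_one_le_right hn0.le this
    linarith
  have h1R : (h 1 : ℝ) ≠ 0 := by exact_mod_cast h1
  have h1abs : (1 : ℝ) ≤ |(h 1 : ℝ)| := by exact_mod_cast Int.one_le_abs h1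
  -- the rational `r = −h₀/h₁`
  set r : ℚ := Rat.divInt (-h 0) (h 1) with hr
  have hrR : (r : ℝ) = -(h 0 : ℝ) / (h 1 : ℝ) := by
    rw [hr, Rat.cast_divInt]; push_cast; ring
  have hdist : |ρ - r| = |f| / |(h 1 : ℝ)| := by
    rw [hrR, hf, ← abs_div]
    congr 1
    field_simp
    ring
  have hdist_le : |ρ - r| ≤ |f| := by
    rw [hdist]; exact div_le_self (abs_nonneg _) h1abs
  have hden_le : (r.den : ℝ) ≤ |(h 1 : ℝ)| := by
    have hd : (r.den : ℤ) ∣ h 1 := by rw [hr]; exact Rat.den_dvd _ _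
    have := Int.le_of_dvd (abs_pos.mpr h1) ((dvd_abs _ _).mpr hd)
    exact_mod_cast this
  refine ⟨r, ?_, hρirr.ne_rat r, ?_⟩
  · -- `den r ≥ m`, else `ε ≤ |ρ − r|` contradicts the smallness
    by_contra hlt_m
    have hεr := hε r (by omega)
    have : ε * ‖z 0‖ ≤ ‖z 0‖ * |f| := by
      rw [mul_comm]; exact mul_le_mul_of_nonneg_left (hεr.trans hdist_le) hn0.le
    linarith
  · -- `|ρ − r| ≤ |f| < exp(−(1+S)^M) ≤ exp(−den^m)`
    refine hdist_le.trans_lt (hltB.trans_le ?_)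
    apply Real.exp_le_exp.mpr
    have hdenS : (r.den : ℝ) ≤ 1 + S := by
      have := abs_le_hsum h 1
      linarith
    have : (r.den : ℝ) ^ m ≤ (1 + S) ^ M :=
      calc (r.den : ℝ) ^ m ≤ (1 + S) ^ m := pow_le_pow_left₀ (by positivity) hdenS m
        _ ≤ (1 + S) ^ M := pow_le_pow_right₀ (by linarith) (by omega)
    linarith

/-- Conversely, **`(t, ρt)` is `HyperLinLiouville` for every real hyper-Liouville `ρ` and every
`t`**: the approximations `p/q` of `ρ` give the forms `−p·t + q·(ρt) = t·q(ρ − p/q)` of size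
`≤ ‖t‖ q exp(−q^M)`, against the required `exp(−(1 + |p| + q)^m) ≥ exp(−((|ρ|+3)q)^m)`. -/
theorem hyperLinLiouville_of_hyperLiouville_ratio {ρ : ℝ} (hρ : HyperLiouville ρ) (t : ℂ) :
    HyperLinLiouville ![t, (ρ : ℂ) * t] := by
  intro m
  set c : ℝ := |ρ| + 3 with hc
  have hc1 : (1 : ℝ) ≤ c := by rw [hc]; linarith [abs_nonneg ρ]
  obtain ⟨r, hden, hne, hlt⟩ := hρ (max (m + 2) ⌈c ^ m + ‖t‖⌉₊)
  set M : ℕ := max (m + 2) ⌈c ^ m + ‖t‖⌉₊ with hM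
  set q : ℕ := r.den with hq
  set p : ℤ := r.num with hp
  have hq0 : q ≠ 0 := r.den_nz
  have hq1 : (1 : ℝ) ≤ q := by exact_mod_cast Nat.one_le_iff_ne_zero.mpr hq0
  have hq0R : (0 : ℝ) < q := by linarith
  have hqM : m + 2 ≤ M := le_max_left _ _
  have hqc : c ^ m + ‖t‖ ≤ q :=
    (Nat.le_ceil _).trans (by exact_mod_cast (le_max_right _ _).trans hden)
  have hrR : (r : ℝ) = (p : ℝ) / q := by rw [hp, hq]; exact Rat.cast_def r
  refine ⟨![-p, (q : ℤ)], ?_, ?_⟩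
  · intro h0
    have := congr_fun h0 1
    simp only [Matrix.cons_val_one, Matrix.cons_val_zero, Pi.zero_apply, Nat.cast_eq_zero] at this
    exact hq0 this
  · have e : ∑ i, ((![-p, (q : ℤ)] : Fin 2 → ℤ) i : ℂ) * (![t, (ρ : ℂ) * t] : Fin 2 → ℂ) i =
        t * (((q : ℝ) * (ρ - r) : ℝ) : ℂ) := by
      rw [Fin.sum_univ_two]
      simp only [Matrix.cons_val_zero, Matrix.cons_val_one]
      rw [hrR]; push_cast; field_simp; ring
    have eS : ∑ i, (|(![-p, (q : ℤ)] : Fin 2 → ℤ) i| : ℝ) = |(p : ℝ)| + q := by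
      rw [hsum_two]
      simp only [Matrix.cons_val_zero, Matrix.cons_val_one, Int.cast_neg, abs_neg,
        Int.cast_natCast, Nat.abs_cast]
    rw [e, eS, norm_mul, Complex.norm_real, Real.norm_eq_abs, abs_mul, abs_of_pos hq0R]
    -- `|p| ≤ q(|ρ| + 1)`, whence `1 + |p| + q ≤ c q`
    have hlt1 : |ρ - r| < 1 := hlt.trans_le (by
      rw [Real.exp_le_one_iff]; linarith [pow_nonneg hq0R.le M])
    have hpq : |(p : ℝ)| ≤ q * (|ρ| + 1) := by
      have h3 : |(r : ℝ)| ≤ |ρ| + 1 := by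
        have h4 : |(r : ℝ)| - |ρ| ≤ |(r : ℝ) - ρ| := abs_sub_abs_le_abs_sub _ _
        rw [abs_sub_comm] at h4
        linarith
      rw [hrR, abs_div, abs_of_pos hq0R, div_le_iff₀ hq0R] at h3
      linarith
    have hS : 1 + (|(p : ℝ)| + q) ≤ c * q := by rw [hc]; nlinarith [abs_nonneg ρ]
    -- the required exponent is dominated: `(1+S)^m ≤ (cq)^m ≤ q^M − ‖t‖ q`
    have hkey : ‖t‖ * q ≤ (q : ℝ) ^ M - (c * q) ^ m := by
      have h1 : (q : ℝ) ^ (m + 2) ≤ (q : ℝ) ^ M := pow_le_pow_right₀ hq1 hqM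
      have h2 : (q : ℝ) ^ (m + 2) = (q : ℝ) ^ m * q * q := by ring
      have hqm1 : (1 : ℝ) ≤ (q : ℝ) ^ m := one_le_pow₀ hq1
      have h3 : (c * q) ^ m + ‖t‖ * q ≤ (q : ℝ) ^ m * q * q := by
        rw [mul_pow]
        have h4 : (q : ℝ) ^ m * q * (c ^ m + ‖t‖) ≤ (q : ℝ) ^ m * q * q := by gcongr
        have h5 : c ^ m * (q : ℝ) ^ m ≤ c ^ m * (q : ℝ) ^ m * q :=
          le_mul_of_one_le_right (by positivity) hq1
        have h6 : ‖t‖ * (q : ℝ) ≤ ‖t‖ * q * (q : ℝ) ^ m :=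
          le_mul_of_one_le_right (by positivity) hqm1
        nlinarith
      linarith
    have hstrict : ‖t‖ * q < Real.exp ((q : ℝ) ^ M - (c * q) ^ m) :=
      hkey.trans_lt (by linarith [Real.add_one_le_exp ((q : ℝ) ^ M - (c * q) ^ m)])
    calc ‖t‖ * ((q : ℝ) * |ρ - r|) ≤ ‖t‖ * ((q : ℝ) * Real.exp (-((q : ℝ) ^ M))) := by
          gcongr
      _ = ‖t‖ * q * Real.exp (-((q : ℝ) ^ M)) := by ring
      _ < Real.exp ((q : ℝ) ^ M - (c * q) ^ m) * Real.exp (-((q : ℝ) ^ M)) := by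
          gcongr
      _ = Real.exp (-((c * q) ^ m)) := by rw [← Real.exp_add]; ring_nf
      _ ≤ Real.exp (-((1 + (|(p : ℝ)| + q)) ^ m)) := by
          apply Real.exp_le_exp.mpr
          have : (1 + (|(p : ℝ)| + q)) ^ m ≤ (c * q) ^ m :=
            pow_le_pow_left₀ (by positivity) hS m
          linarith

/-- **Level 2 of the round-4 cut, exactly**: a ℚ-free pair is `HyperLinLiouville` iff its ratio
is a real hyper-Liouville number. -/
theorem hyperLinLiouville_pair_iff {z : Fin 2 → ℂ} (hz : LinearIndependent ℚ z) :
    HyperLinLiouville z ↔ ∃ ρ : ℝ, HyperLiouville ρ ∧ z 1 = (ρ : ℂ) * z 0 := by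
  refine ⟨exists_hyperLiouville_ratio_of_hyperLinLiouville hz, ?_⟩
  rintro ⟨ρ, hρ, h1⟩
  have ez : z = ![z 0, (ρ : ℂ) * z 0] := by
    funext i; fin_cases i
    · rfl
    · simpa using h1
  rw [ez]
  exact hyperLinLiouville_of_hyperLiouville_ratio hρ (z 0)

/-- A pair `(t, x t)` with `x` real and NOT hyper-Liouville, `t ≠ 0`, is not `HyperLinLiouville`. -/
theorem not_hyperLinLiouville_of_ratio_not_hyperLiouville {t : ℂ} {x : ℝ} (hx : ¬ HyperLiouville x)
    (hz : LinearIndependent ℚ ![t, (x : ℂ) * t]) : ¬ HyperLinLiouville ![t, (x : ℂ) * t] := by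
  intro hH
  obtain ⟨ρ, hρ, h1⟩ := exists_hyperLiouville_ratio_of_hyperLinLiouville hz hH
  have ht : t ≠ 0 := hz.ne_zero 0
  have h1' : (x : ℂ) * t = (ρ : ℂ) * t := by simpa using h1
  have hx' : (x : ℂ) = (ρ : ℂ) := mul_right_cancel₀ ht h1'
  have : x = ρ := by exact_mod_cast hx'
  exact hx (this ▸ hρ)

/-- `(ℓ, ℓ²)` for hyper-Liouville `ℓ` is a hyper-Liouville point. -/
theorem hyperLinLiouville_sq {ℓ : ℝ} (hℓ : HyperLiouville ℓ) :
    HyperLinLiouville ![(ℓ : ℂ), (ℓ : ℂ) ^ 2] := by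
  rw [sq]; exact hyperLinLiouville_of_hyperLiouville_ratio hℓ (ℓ : ℂ)

/-- `(1, ℓ)` for hyper-Liouville `ℓ`. -/
theorem hyperLinLiouville_one {ℓ : ℝ} (hℓ : HyperLiouville ℓ) :
    HyperLinLiouville ![(1 : ℂ), (ℓ : ℂ)] := by
  simpa using hyperLinLiouville_of_hyperLiouville_ratio hℓ (1 : ℂ)

/-- `(1, ℓ, w)` for hyper-Liouville `ℓ` and ANY `w` (prefix `(1, ℓ)`). -/
theorem hyperLinLiouville_one_any {ℓ : ℝ} (hℓ : HyperLiouville ℓ) (w : ℂ) :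
    HyperLinLiouville ![(1 : ℂ), (ℓ : ℂ), w] := by
  refine hyperLinLiouville_of_prefix (k := 2) (by omega) ?_
  have h2 : (fun i : Fin 2 => (![(1 : ℂ), (ℓ : ℂ), w] : Fin 3 → ℂ)
      (Fin.castLE (show 2 ≤ 3 by omega) i)) = ![(1 : ℂ), (ℓ : ℂ)] := by
    funext i; fin_cases i <;> rfl
  rw [h2]; exact hyperLinLiouville_one hℓ

/-- The moment curve `(ℓ, ℓ², …, ℓⁿ)`, `n ≥ 2`, for hyper-Liouville `ℓ` (prefix `(ℓ, ℓ²)`). -/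
theorem hyperLinLiouville_momentCurve {ℓ : ℝ} (hℓ : HyperLiouville ℓ) {n : ℕ} (hn : 2 ≤ n) :
    HyperLinLiouville (fun i : Fin n => (ℓ : ℂ) ^ ((i : ℕ) + 1)) := by
  refine hyperLinLiouville_of_prefix hn ?_
  have h2 : (fun i : Fin 2 => (ℓ : ℂ) ^ (((Fin.castLE hn i : Fin n) : ℕ) + 1)) =
      ![(ℓ : ℂ), (ℓ : ℂ) * ℓ] := by
    funext i
    fin_cases i <;> simp [pow_succ]
  rw [h2]
  exact hyperLinLiouville_of_hyperLiouville_ratio hℓ (ℓ : ℂ)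

/-- The exponent tower `a₀ = 1`, `a_{k+1} = 2^{(k+1)·a_k}` (`1, 2, 16, 2⁴⁸, 2^{4·2⁴⁸}, …`). -/
def hexp : ℕ → ℕ
  | 0 => 1
  | k + 1 => 2 ^ ((k + 1) * hexp k)

/-- §17d. An EXPLICIT hyper-Liouville number: λ_H = Σ_k 2^{−a_k}, a₀ = 1, a_{k+1} = 2^{(k+1)·a: auxiliary statement `hexp_zero` (lens 6 gen 9 node, ported verbatim). -/
@[simp] theorem hexp_zero : hexp 0 = 1 := rfl

/-- §17d. An EXPLICIT hyper-Liouville number: λ_H = Σ_k 2^{−a_k}, a₀ = 1, a_{k+1} = 2^{(k+1)·a: auxiliary statement `hexp_succ` (lens 6 gen 9 node, ported verbatim). -/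
theorem hexp_succ (k : ℕ) : hexp (k + 1) = 2 ^ ((k + 1) * hexp k) := rfl

/-- §17d. An EXPLICIT hyper-Liouville number: λ_H = Σ_k 2^{−a_k}, a₀ = 1, a_{k+1} = 2^{(k+1)·a: auxiliary statement `one_le_hexp` (lens 6 gen 9 node, ported verbatim). -/
theorem one_le_hexp (k : ℕ) : 1 ≤ hexp k := by
  cases k with
  | zero => simp
  | succ k => rw [hexp_succ]; exact Nat.one_le_two_pow

/-- §17d. An EXPLICIT hyper-Liouville number: λ_H = Σ_k 2^{−a_k}, a₀ = 1, a_{k+1} = 2^{(k+1)·a: auxiliary statement `hexp_lt_succ` (lens 6 gen 9 node, ported verbatim). -/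
theorem hexp_lt_succ (k : ℕ) : hexp k < hexp (k + 1) := by
  rw [hexp_succ]
  calc hexp k < 2 ^ hexp k := Nat.lt_two_pow_self
    _ ≤ 2 ^ ((k + 1) * hexp k) :=
        Nat.pow_le_pow_right (by norm_num) (Nat.le_mul_of_pos_left _ (by omega))

/-- §17d. An EXPLICIT hyper-Liouville number: λ_H = Σ_k 2^{−a_k}, a₀ = 1, a_{k+1} = 2^{(k+1)·a: auxiliary statement `succ_le_hexp` (lens 6 gen 9 node, ported verbatim). -/
theorem succ_le_hexp (k : ℕ) : k + 1 ≤ hexp k := by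
  induction k with
  | zero => simp
  | succ k ih => exact Nat.succ_le_of_lt (lt_of_le_of_lt ih (hexp_lt_succ k))

/-- §17d. An EXPLICIT hyper-Liouville number: λ_H = Σ_k 2^{−a_k}, a₀ = 1, a_{k+1} = 2^{(k+1)·a: auxiliary statement `hexp_add_le` (lens 6 gen 9 node, ported verbatim). -/
theorem hexp_add_le (K j : ℕ) : hexp K + j ≤ hexp (K + j) := by
  induction j with
  | zero => simp
  | succ j ih =>
      have := hexp_lt_succ (K + j)
      show hexp K + (j + 1) ≤ hexp (K + j + 1)
      omega

/-- §17d. An EXPLICIT hyper-Liouville number: λ_H = Σ_k 2^{−a_k}, a₀ = 1, a_{k+1} = 2^{(k+1)·a: auxiliary statement `hexp_strictMono` (lens 6 gen 9 node, ported verbatim). -/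
theorem hexp_strictMono : StrictMono hexp := strictMono_nat_of_lt_succ hexp_lt_succ

/-- **`λ_H`** — the explicit hyper-Liouville constant `Σ_k 2^{−a_k}`. -/
def lambdaH : ℝ := ∑' k, 1 / (2 : ℝ) ^ hexp k

/-- §17d. An EXPLICIT hyper-Liouville number: λ_H = Σ_k 2^{−a_k}, a₀ = 1, a_{k+1} = 2^{(k+1)·a: auxiliary statement `summable_lambdaH` (lens 6 gen 9 node, ported verbatim). -/
theorem summable_lambdaH : Summable fun k => 1 / (2 : ℝ) ^ hexp k :=
  summable_one_div_pow_of_le (by norm_num) fun k => (Nat.le_succ k).trans (succ_le_hexp k)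

/-- The partial sums: `Σ_{k ≤ K} 2^{−a_k} = M / 2^{a_K}` with `M` ODD. -/
theorem lambdaH_partialSum (K : ℕ) :
    ∃ M : ℕ, Odd M ∧ ∑ k ∈ Finset.range (K + 1), 1 / (2 : ℝ) ^ hexp k = M / (2 : ℝ) ^ hexp K := by
  induction K with
  | zero => exact ⟨1, odd_one, by simp⟩
  | succ K ih =>
      obtain ⟨M, hM, hsum⟩ := ih
      have hlt := hexp_lt_succ K
      refine ⟨M * 2 ^ (hexp (K + 1) - hexp K) + 1, ?_, ?_⟩
      · refine Even.add_one (Even.mul_left ?_ _)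
        exact (Nat.even_pow' (by omega)).mpr (by decide)
      · rw [Finset.sum_range_succ, hsum]
        have h2 : (2 : ℝ) ^ hexp (K + 1) = 2 ^ hexp K * 2 ^ (hexp (K + 1) - hexp K) := by
          rw [← pow_add, Nat.add_sub_cancel' hlt.le]
        rw [div_add_div _ _ (by positivity) (by positivity), div_eq_div_iff (by positivity)
          (by positivity)]
        push_cast
        rw [h2]
        ring

/-- The tail `Σ_{k ≥ K} 2^{−a_k}` is positive and at most `2 · 2^{−a_K}`. -/
theorem lambdaH_tail_pos (K : ℕ) : 0 < ∑' k, 1 / (2 : ℝ) ^ hexp (k + K) :=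
  ((summable_nat_add_iff K).mpr summable_lambdaH).tsum_pos (fun _ => by positivity) 0
    (by positivity)

/-- §17d. An EXPLICIT hyper-Liouville number: λ_H = Σ_k 2^{−a_k}, a₀ = 1, a_{k+1} = 2^{(k+1)·a: auxiliary statement `lambdaH_tail_le` (lens 6 gen 9 node, ported verbatim). -/
theorem lambdaH_tail_le (K : ℕ) :
    ∑' k, 1 / (2 : ℝ) ^ hexp (k + K) ≤ 2 * (1 / (2 : ℝ) ^ hexp K) := by
  have hgeom : Summable fun k : ℕ => ((1 : ℝ) / 2) ^ k * (1 / (2 : ℝ) ^ hexp K) :=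
    (summable_geometric_two).mul_right _
  calc ∑' k, 1 / (2 : ℝ) ^ hexp (k + K) ≤ ∑' k : ℕ, ((1 : ℝ) / 2) ^ k * (1 / (2 : ℝ) ^ hexp K) := by
        refine Summable.tsum_le_tsum (fun k => ?_) ((summable_nat_add_iff K).mpr summable_lambdaH)
          hgeom
        have hle : hexp K + k ≤ hexp (k + K) := by rw [Nat.add_comm k K]; exact hexp_add_le K k
        rw [one_div_pow, one_div_mul_one_div, ← pow_add, Nat.add_comm k (hexp K)]
        exact one_div_pow_le_one_div_pow_of_le (by norm_num) hle
    _ = 2 * (1 / (2 : ℝ) ^ hexp K) := by rw [tsum_mul_right, tsum_geometric_two]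

/-- §17d. An EXPLICIT hyper-Liouville number: λ_H = Σ_k 2^{−a_k}, a₀ = 1, a_{k+1} = 2^{(k+1)·a: auxiliary statement `lambdaH_eq_partialSum_add_tail` (lens 6 gen 9 node, ported verbatim). -/
theorem lambdaH_eq_partialSum_add_tail (K : ℕ) :
    lambdaH = ∑ k ∈ Finset.range K, 1 / (2 : ℝ) ^ hexp k + ∑' k, 1 / (2 : ℝ) ^ hexp (k + K) :=
  (summable_lambdaH.sum_add_tsum_nat_add K).symm

/-- §17d. An EXPLICIT hyper-Liouville number: λ_H = Σ_k 2^{−a_k}, a₀ = 1, a_{k+1} = 2^{(k+1)·a: auxiliary statement `exp_one_le_three` (lens 6 gen 9 node, ported verbatim). -/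
private theorem exp_one_le_three : Real.exp 1 ≤ 3 := by
  have := Real.exp_one_lt_d9; norm_num at this; linarith

/-- `(1/3)^X ≤ exp(−X)`. -/
private theorem third_pow_le_exp_neg (X : ℕ) : ((1 : ℝ) / 3) ^ X ≤ Real.exp (-(X : ℝ)) := by
  have h1 : (1 : ℝ) / 3 ≤ Real.exp (-1) := by
    rw [Real.exp_neg, ← one_div]
    exact one_div_le_one_div_of_le (Real.exp_pos 1) exp_one_le_three
  calc ((1 : ℝ) / 3) ^ X ≤ Real.exp (-1) ^ X := pow_le_pow_left₀ (by norm_num) h1 X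
    _ = Real.exp (-(X : ℝ)) := by rw [← Real.exp_nat_mul]; ring_nf

/-- `2 · 16^{−X} < 3^{−X}` for `X ≥ 1`. -/
private theorem two_mul_sixteenth_pow_lt {X : ℕ} (hX : 1 ≤ X) :
    2 * ((1 : ℝ) / 16) ^ X < ((1 : ℝ) / 3) ^ X := by
  have e : ((1 : ℝ) / 3) ^ X = ((16 : ℝ) / 3) ^ X * ((1 : ℝ) / 16) ^ X := by
    rw [← mul_pow]; norm_num
  rw [e]
  have h : (2 : ℝ) < ((16 : ℝ) / 3) ^ X :=
    calc (2 : ℝ) < 16 / 3 := by norm_num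
      _ ≤ ((16 : ℝ) / 3) ^ X := le_self_pow₀ (by norm_num) (by omega)
  exact mul_lt_mul_of_pos_right h (by positivity)

end HyperCell

end Summit.Schanuel.Schanuel.Theorems.RootDecomp1KHyper
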